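import Summits.QuantumFields.BalabanUV.T4Continuum.Support.NE7EtaBackgroundCloseness
import Summits.QuantumFields.BalabanUV.T4Continuum.Support.MinimalActionExistence

/-!
# NE7EtaBackgroundBinders — route #1 of the NE7 crux, stub S7 (NODE O, the BACKGROUND COORDINATE): the binders `hexA`, `hexB` of
# `hclose_of_covRoot` REDUCED BY NAME to row NE3's binders (H2) (refinement ⇒ existence by compactness, `MinimalActionExistence`) and (H3)
# (regularity) plus ONE new letter — the smooth gauge of the run-B minimiser under the sector∕size side condition (NEEDS-SIDE-CONDITION #S1)

Cell `pub-balaban`, rung (B)+1 sub-cell t4, lineage `b2b-balaban-t4-ne7-p1`, generation 25 (CRUX PROVER NE7 #1, ruling e34b3e0c); crux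
skeleton `t4/skeletons/NE7-CRUX-R1.md` v1.7.5 §3sexies ∕ §5 (G5); sequel of `NE7EtaBackgroundCloseness` (p258604).  HONEST FRAMING (page 1):
FIXED FINITE T⁴, rung (B)+1; NE7, NE3 NOT PRINTED in [Balaban1984PropagatorsI]–[Balaban1989LargeFieldII] and NOT PROVED here; continuum YM on
T⁴ ⇐ BetaPertH ∧ nine spine estimates (0/9 proved); BetaPertH ⇐ (D1) ∧ (D4) ∧ CAP+tail; G-an2-4 gates asym, D1 and NE2/3/4; NOT infinite
volume, NOT mass gap, NOT Clay.

WHY.  The bill (G5) of NODE O's background coordinate must be sized BY NAME against what the sibling rows already carry.  `hclose_of_covRoot`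
(p258604) displays `hexA` (run-A minimisers exist) and `hexB` (run-B minimiser exists, is `Regular`, and admits a global smooth gauge under
`hsector`).  Row NE3's formalisation swarm has ALREADY typed and partly discharged the existence∕regularity binders for the SAME class
`MinimalActionRate.sfClass`: `MinimalActionExistence.exists_isMinimiser_of_refine` (leaf A-H1-cpt: minimisers exist at EVERY level for a level-0
small-field datum, by COMPACTNESS, modulo the (H2) refinement binder «every minimiser is the rescaled one-step average of some configuration of
the next class»), and (H3) «minimisers of run `k+1` are `Regular d L N b g (k+1)`» ([Balaban1985Variational] Thm 1 (8)–(10) p. 279 TYPE) is the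
regularity binder of NE3's END-A.  WHAT ([folklore]; 0 def):
 * `hexA_of_refine` — `hexA` ⇐ `dom ⊆ sfClass 4 L N ε 0` + the radius regime (`16·C₀·ε ≤ 3`, `1024·5·8·L²·ε ≤ 1`) + (H2), BY NAME.
 * `hexB_of_refine_regular_letter` — `hexB` ⇐ the same + (H3) + the LETTER `hletter`: for every `Regular` run-`(K+1)` minimiser `U_B` of a datum
   of `dom`, IF `n·N²·ε ≤ c₀` THEN in SOME unitary `N·L^{K+1}`-periodic gauge `U_B^{u_B} = exp A_B` bondwise with `sup‖A_B‖ ≤ σ_B·θ^{6(K+1)}`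
   (LOCAL printed-TYPE [Balaban1985Variational] Thm 1 (9) p. 279 — cube `2ML^jη`, `M ≤ M(ε₁)`, a gauge on a neighbourhood of the cube — +
   UNPRINTED torus globalisation (comb gauge, holonomy spreading, smoothing) satisfiable only in the trivial flux∕Lüscher sector, which
   `n·N²·ε ≤ c₀` with a small absolute `c₀` enforces on the class; `σ_B = σ_B(N)`; asserted nowhere; NOT a Literature fact — tripwire (t15)).
 * **`hclose_of_refine_regular_letter`** — `hclose_of_covRoot_occ` with `hexA`, `hexB` so discharged: the closeness binder of
   `uRateUpTo_tower` on `occCarriers` from NE3's covariant root (amendment 4) + (H2) + (H3) + `hdom` + K-free `LevelSmall` + `hsector` + the LETTER.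
CONSEQUENCE FOR THE BILL (G5): apart from NE3's own binders (root T-E_w + (Lip₁ᶜ)(Lip₂′ᶜ), (H2), (H3)), the background coordinate of NODE O
costs EXACTLY ONE new binder — the LETTER under `hsector` (S–M: local printed-TYPE + unprinted globalisation) — and the functionals' half
(T.2's remaining data, (G5)(4)).  HONEST.  Composition BY NAME; (H2), (H3), the root and the letter are HYPOTHESES; nothing of NE3∕NE7
discharged; 0 def; 0 sorry.
-/

set_option autoImplicit false

open scoped BigOperators Matrix Matrix.Norms.L2Operator
open Finset NormedSpace

namespace Summit.QuantumFields.BalabanUV.T4Continuum.NE7EtaBackgroundBinders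

open Literature.MathematicalPhysics.QuantumFieldTheory.Balaban1983to89
open B7Prop1Explicit B7Prop2Explicit
open T4AveragingDeficitWall hiding Site Plane Plaq Bond
open T4AveragingDeficitWallBoundary (periodBox IsPeriodicCfg)
open T4OutputRate (Carriers)
open AveragingDeficitPeriodicCounting (IsPeriodicDir)
open AveragingDeficitMultiLevelPrep (LevelSmall)
open MinimalActionSandwich (IsMinimiser)
open MinimalActionRate (Regular sfClass)
open NE3EnergyShapes (residualScale IsUnitarySite IsPeriodicSite)
open NE3EnergyWeightedShapes (energyNormW)
open AveragingDeficitDualResidual (dualC1 dualC2)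
open AveragingDeficitDerivWallProof (wallConst)
open MinimalActionExistence (exists_isMinimiser_of_refine)
open NE7EtaBackgroundCarrier NE7EtaBackgroundCloseness

noncomputable section

variable {n : Type} [Fintype n] [DecidableEq n] [Nonempty n]

/-! ## §1 `hexA` and `hexB` from row NE3's binders (H2), (H3) and ONE new letter -/

/-- **`hexA` IS ROW NE3's (H1), KERNEL MODULO (H2)**: on a domain of level-0 small-field data, with the class radius in the regime of
`MinimalActionExistence` (`16·C₀·ε ≤ 3`, `1024·5·8·L²·ε ≤ 1`) and the (H2)-refinement binder of row NE3 (every minimiser of every run is the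
rescaled one-step average of SOME configuration of the next class), run-A minimisers exist at EVERY level for every datum
(`MinimalActionExistence.exists_isMinimiser_of_refine`, compactness) — in particular the binder `hexA` of `hclose_of_covRoot`. [folklore] -/
theorem hexA_of_refine {L N : ℕ} (hL : 2 ≤ L) {ε : ℝ} (hε0 : 0 ≤ ε) (hε1 : 16 * C0 4 * ε ≤ 3)
    (hε2 : 1024 * (4 + 1) * (4 + 4) * (L : ℝ) ^ 2 * ε ≤ 1) {dom : Set (Site 4 → Fin 4 → (Matrix n n ℂ)ˣ)}
    (hdom0 : dom ⊆ sfClass 4 L N ε 0)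
    (h2 : ∀ V ∈ dom, ∀ (k : ℕ) (U : Site 4 → Fin 4 → (Matrix n n ℂ)ˣ), IsMinimiser 4 (sfClass 4 L N ε) L N k V U →
      ∃ Ut, Ut ∈ sfClass 4 L N ε (k + 1) ∧ rescale L (bavg L Ut) = U) :
    ∀ K : ℕ, 1 ≤ K → ∀ v ∈ dom, ∃ UA : Site 4 → Fin 4 → (Matrix n n ℂ)ˣ, IsMinimiser 4 (sfClass 4 L N ε) L N K v UA :=
  fun K _ v hv => exists_isMinimiser_of_refine hL hε0 hε1 hε2 (hdom0 hv) (h2 v hv) K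

/-- **`hexB` = (H1) ∧ (H3) ∧ ONE NEW LETTER**: with (H2) (existence through refinement, as above), row NE3's regularity binder (H3) «every
run-`(K+1)` minimiser is `Regular 4 L N b g (K+1)`» ([Balaban1985Variational] Thm 1 (8)–(10) p. 279 TYPE, one-run, asserted nowhere), and the
SMOOTH-GAUGE LETTER displayed with the sector∕size side condition — for every `Regular` run-`(K+1)` minimiser `U_B` of a datum of `dom`, IF
`n·N²·ε ≤ c₀` THEN in SOME unitary `N·L^{K+1}`-periodic gauge `u_B`, `U_B^{u_B}` is bondwise `exp A_B` with `sup‖A_B‖ ≤ σ_B·θ^{6(K+1)}` (LOCAL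
printed-TYPE [Balaban1985Variational] Thm 1 (9) p. 279 + UNPRINTED torus globalisation under the side condition; `σ_B = σ_B(N)`; NOT a
Literature fact; NEEDS-SIDE-CONDITION #S1 of the crux refuter) — the binder `hexB` of `hclose_of_covRoot` follows.  So the ONLY binder of
NODE O's background coordinate that is not already a binder of row NE3 is this letter. [folklore] -/
theorem hexB_of_refine_regular_letter {L N : ℕ} (hL : 2 ≤ L) {ε : ℝ} (hε0 : 0 ≤ ε) (hε1 : 16 * C0 4 * ε ≤ 3)
    (hε2 : 1024 * (4 + 1) * (4 + 4) * (L : ℝ) ^ 2 * ε ≤ 1) {dom : Set (Site 4 → Fin 4 → (Matrix n n ℂ)ˣ)}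
    (hdom0 : dom ⊆ sfClass 4 L N ε 0)
    (h2 : ∀ V ∈ dom, ∀ (k : ℕ) (U : Site 4 → Fin 4 → (Matrix n n ℂ)ˣ), IsMinimiser 4 (sfClass 4 L N ε) L N k V U →
      ∃ Ut, Ut ∈ sfClass 4 L N ε (k + 1) ∧ rescale L (bavg L Ut) = U)
    {b g : ℝ}
    (h3 : ∀ V ∈ dom, ∀ (k : ℕ) (U : Site 4 → Fin 4 → (Matrix n n ℂ)ˣ),
      IsMinimiser 4 (sfClass 4 L N ε) L N (k + 1) V U → Regular 4 L N b g (k + 1) U)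
    {θ σB c₀ : ℝ}
    (hletter : ∀ K : ℕ, 1 ≤ K → ∀ v ∈ dom, ∀ UB : Site 4 → Fin 4 → (Matrix n n ℂ)ˣ,
      IsMinimiser 4 (sfClass 4 L N ε) L N (K + 1) v UB → Regular 4 L N b g (K + 1) UB →
        (Fintype.card n : ℝ) * (N : ℝ) ^ 2 * ε ≤ c₀ →
        ∃ uB : Site 4 → (Matrix n n ℂ)ˣ, IsUnitarySite uB ∧ IsPeriodicSite uB ((N * L ^ (K + 1) : ℕ) : ℤ) ∧
          ∃ AB : Site 4 → Fin 4 → Matrix n n ℂ, ∀ (x : Site 4) (κ : Fin 4),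
            ((gaugeAct uB UB x κ : (Matrix n n ℂ)ˣ) : Matrix n n ℂ) = exp (AB x κ) ∧ ‖AB x κ‖ ≤ σB * θ ^ (6 * (K + 1))) :
    ∀ K : ℕ, 1 ≤ K → ∀ v ∈ dom, (Fintype.card n : ℝ) * (N : ℝ) ^ 2 * ε ≤ c₀ →
      ∃ UB : Site 4 → Fin 4 → (Matrix n n ℂ)ˣ, IsMinimiser 4 (sfClass 4 L N ε) L N (K + 1) v UB ∧ Regular 4 L N b g (K + 1) UB ∧
        ∃ uB : Site 4 → (Matrix n n ℂ)ˣ, IsUnitarySite uB ∧ IsPeriodicSite uB ((N * L ^ (K + 1) : ℕ) : ℤ) ∧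
          ∃ AB : Site 4 → Fin 4 → Matrix n n ℂ, ∀ (x : Site 4) (κ : Fin 4),
            ((gaugeAct uB UB x κ : (Matrix n n ℂ)ˣ) : Matrix n n ℂ) = exp (AB x κ) ∧ ‖AB x κ‖ ≤ σB * θ ^ (6 * (K + 1)) := by
  intro K hK v hv hsec
  obtain ⟨UB, hUB⟩ := exists_isMinimiser_of_refine hL hε0 hε1 hε2 (hdom0 hv) (h2 v hv) (K + 1)
  have hreg : Regular 4 L N b g (K + 1) UB := h3 v hv K UB hUB
  obtain ⟨uB, hu, huP, AB, hAB⟩ := hletter K hK v hv UB hUB hreg hsec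
  exact ⟨UB, hUB, hreg, uB, hu, huP, AB, hAB⟩

/-! ## §2 The closeness binder on the occurring classes from row NE3's binders and the one new letter -/

/-- **`hclose` ON `occCarriers` FROM ROW NE3's BINDERS + ONE LETTER** — `hclose_of_covRoot_occ` with `hexA`, `hexB` DISCHARGED from: `dom` a
gauge-invariant set of level-0 small-field data, the class radius in the regime of `MinimalActionExistence`, row NE3's (H2) refinement and
(H3) regularity binders, NE3's covariant root (amendment 4) — ALL THREE already binders of row NE3 —, and the smooth-gauge LETTER under the
sector∕size side condition `hsector` (the only binder proper to NODE O's background coordinate; LOCAL printed-TYPE + UNPRINTED globalisation,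
asserted nowhere).  Conclusion verbatim that of `hclose_of_covRoot_occ`. [folklore] -/
theorem hclose_of_refine_regular_letter {L N : ℕ} (hL : 2 ≤ L) (hN : 1 ≤ N) {θ : ℝ} (hθ : 0 < θ)
    (hθ6 : θ ^ 6 = ((L : ℝ))⁻¹) {ε : ℝ} (hε : 0 ≤ ε) (hε1 : 16 * C0 4 * ε ≤ 3)
    (hε2 : 1024 * (4 + 1) * (4 + 4) * (L : ℝ) ^ 2 * ε ≤ 1) (hls : ∀ j : ℕ, LevelSmall 4 L j (ε / ((L : ℝ) ^ (j + 1)) ^ 2))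
    {b g C Λ₁ Λ₂' : ℝ} (hb : 0 ≤ b) (hbs : 512 * (4 + 1) * (4 + 4) * (L : ℝ) ^ 2 * b ≤ 1) (hg : 0 ≤ g) (hC : 0 ≤ C)
    (hΛ₂' : 0 < Λ₂') {dom : Set (Site 4 → Fin 4 → (Matrix n n ℂ)ˣ)} (hdom0 : dom ⊆ sfClass 4 L N ε 0)
    (hdom : ∀ v ∈ dom, ∀ w : Site 4 → (Matrix n n ℂ)ˣ, IsUnitarySite w → IsPeriodicSite w (N : ℤ) → gaugeAct w v ∈ dom)
    (h2 : ∀ V ∈ dom, ∀ (k : ℕ) (U : Site 4 → Fin 4 → (Matrix n n ℂ)ˣ), IsMinimiser 4 (sfClass 4 L N ε) L N k V U →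
      ∃ Ut, Ut ∈ sfClass 4 L N ε (k + 1) ∧ rescale L (bavg L Ut) = U)
    (h3 : ∀ V ∈ dom, ∀ (k : ℕ) (U : Site 4 → Fin 4 → (Matrix n n ℂ)ˣ),
      IsMinimiser 4 (sfClass 4 L N ε) L N (k + 1) V U → Regular 4 L N b g (k + 1) U)
    (h : ∀ k : ℕ, 1 ≤ k → ∀ V ∈ dom, ∀ UA UB : Site 4 → Fin 4 → (Matrix n n ℂ)ˣ,
      IsMinimiser 4 (sfClass 4 L N ε) L N k V UA → IsMinimiser 4 (sfClass 4 L N ε) L N (k + 1) V UB →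
        Regular 4 L N b g (k + 1) UB →
        ∃ (u : Site 4 → (Matrix n n ℂ)ˣ) (Z : Site 4 → Fin 4 → Matrix n n ℂ),
          IsUnitarySite u ∧ IsPeriodicSite u ((N * L ^ k : ℕ) : ℤ) ∧
          IsSkewDir Z ∧ IsPeriodicDir Z ((N * L ^ k : ℕ) : ℤ) ∧
          gaugeAct u UA = vary (rescale L (bavg L UB)) Z 1 ∧
          energyNormW L k (rescale L (bavg L UB)) Z (periodBox (N * L ^ k)) ≤ C * residualScale 4 L N b g k ∧
          (∀ (κ : Fin 4) (x : Site 4) (μ : Fin 4),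
            ‖Ad (rescale L (bavg L UB) (x + e κ) μ) (Z (x + e μ) κ) - Z x κ‖ ≤ Λ₁ * (((L : ℝ)⁻¹) ^ k) ^ 2) ∧
          (∀ (κ μ : Fin 4) (y : Site 4),
            ‖Ad (rescale L (bavg L UB) (y + e κ) μ)
                (Ad (rescale L (bavg L UB) (y + e κ + e μ) μ) (Z (y + (2 : ℕ) • e μ) κ) - Z (y + e μ) κ)
              - (Ad (rescale L (bavg L UB) (y + e κ) μ) (Z (y + e μ) κ) - Z y κ)‖ ≤ Λ₂' * (((L : ℝ)⁻¹) ^ k) ^ 3))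
    {γ l₁ : ℝ} (hγ : 0 < γ)
    (hγ3 : C * (wallConst 4 L * (N : ℝ) ^ 2 * (Real.sqrt g * dualC2 4 L + 2 * b ^ 2 * dualC1 4 L)) ≤ γ ^ 3)
    (hl₁ : 0 < l₁) (hΛl₁ : Λ₁ ≤ l₁ ^ 3)
    {σB c₀ : ℝ} (hσB : 0 ≤ σB) (hsector : (Fintype.card n : ℝ) * (N : ℝ) ^ 2 * ε ≤ c₀)
    (hletter : ∀ K : ℕ, 1 ≤ K → ∀ v ∈ dom, ∀ UB : Site 4 → Fin 4 → (Matrix n n ℂ)ˣ,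
      IsMinimiser 4 (sfClass 4 L N ε) L N (K + 1) v UB → Regular 4 L N b g (K + 1) UB →
        (Fintype.card n : ℝ) * (N : ℝ) ^ 2 * ε ≤ c₀ →
        ∃ uB : Site 4 → (Matrix n n ℂ)ˣ, IsUnitarySite uB ∧ IsPeriodicSite uB ((N * L ^ (K + 1) : ℕ) : ℤ) ∧
          ∃ AB : Site 4 → Fin 4 → Matrix n n ℂ, ∀ (x : Site 4) (κ : Fin 4),
            ((gaugeAct uB UB x κ : (Matrix n n ℂ)ˣ) : Matrix n n ℂ) = exp (AB x κ) ∧ ‖AB x κ‖ ≤ σB * θ ^ (6 * (K + 1)))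
    (D : Type) (sc : D → ℕ) (dl : D → ℝ) (hdl : ∀ X, 0 ≤ dl X) :
    ∃ (uA : ℕ → (Site 4 → Fin 4 → (Matrix n n ℂ)ˣ) → (occCarriers n L N ε dom D sc dl hdl).BgA)
      (uB : ℕ → (Site 4 → Fin 4 → (Matrix n n ℂ)ˣ) → (occCarriers n L N ε dom D sc dl hdl).BgB) (K₀ : ℕ) (C₃ : ℝ),
      0 ≤ C₃ ∧
      (∀ K : ℕ, K₀ ≤ K → ∀ v ∈ dom, ∃ (UA UB : Site 4 → Fin 4 → (Matrix n n ℂ)ˣ) (wA wB : Site 4 → (Matrix n n ℂ)ˣ),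
        IsMinimiser 4 (sfClass 4 L N ε) L N K v UA ∧ IsMinimiser 4 (sfClass 4 L N ε) L N (K + 1) v UB ∧
        Regular 4 L N b g (K + 1) UB ∧ IsUnitarySite wA ∧ IsPeriodicSite wA ((N * L ^ K : ℕ) : ℤ) ∧
        IsUnitarySite wB ∧ IsPeriodicSite wB ((N * L ^ (K + 1) : ℕ) : ℤ) ∧
        (uA K v).1 = (K, gaugeAct wA UA) ∧ (uB K v).1 = (K, gaugeAct wB UB)) ∧
      (∀ (K : ℕ) (v : Site 4 → Fin 4 → (Matrix n n ℂ)ˣ), ¬ (K₀ ≤ K ∧ v ∈ dom) →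
        (uA K v).1 = (K, 1) ∧ (uB K v).1 = (K, 1)) ∧
      ∀ K : ℕ, ∀ v ∈ dom, (occCarriers n L N ε dom D sc dl hdl).gauge (uA K v)
          ((occCarriers n L N ε dom D sc dl hdl).transport (uB K v))
        ≤ C₃ * θ ^ K :=
  hclose_of_covRoot_occ hL hN hθ hθ6 hε hls hb hbs hg hC hΛ₂' hdom h hγ hγ3 hl₁ hΛl₁ (hexA_of_refine hL hε hε1 hε2 hdom0 h2) hσB
    hsector (hexB_of_refine_regular_letter hL hε hε1 hε2 hdom0 h2 h3 hletter) D sc dl hdl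

end

end Summit.QuantumFields.BalabanUV.T4Continuum.NE7EtaBackgroundBinders
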